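import Literature.NumberTheory.Sieve.TypeTwoCoefficients
import Literature.NumberTheory.Sieve.PrimitiveReduction
import HarnessLib

/-!
# `∑_{N𝔤 ≤ Q} 1/φ(𝔤) ≪ (log Q)²` (the elementary fact of Hinz 1988, p. 178)

Topic `Literature/NumberTheory/Sieve`, sub-namespace `TotientHarmonic`. Hinz, p. 178: "Using the
elementary fact that `∑_{N𝔮'≤Q} 1/Φ(𝔮𝔮') ≤ Φ(𝔮)⁻¹ ∑_{N𝔮'≤Q} 1/Φ(𝔮') ≪ log Q/Φ(𝔮)` …". We prove
the slightly weaker but sufficient `∑_{N𝔤≤Q} 1/φ(𝔤) ≤ (∑_{N𝔡≤Q} 1/N𝔡)² ≤ C (1 + log Q)²` by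
`1/φ(𝔤) ≤ 2^{ω(𝔤)}/N𝔤 ≤ τ(𝔤)/N𝔤` and `∑ τ(𝔤)/N𝔤 ≤ (∑ 1/N𝔡)²`.

* `two_pow_card_primeFactors_le_card_divisors` — `2^{ω(𝔤)} ≤ τ(𝔤)`;
* `inv_idealTotient_le` — `1/φ(𝔤) ≤ τ(𝔤)/N𝔤`;
* `sum_card_divisors_div_le` — `∑_{N𝔤≤Q} τ(𝔤)/N𝔤 ≤ (∑_{N𝔡≤Q} 1/N𝔡)²`;
* `sum_inv_idealTotient_le`, `sum_inv_idealTotient_le_log_sq` — the conclusions.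

## References

* J. Hinz, Acta Arith. 51 (1988), §2 p. 178. [cite: Hinz1988, §2 p. 178]
-/

noncomputable section

open Finset NumberField Ideal UniqueFactorizationMonoid
  Literature.NumberTheory.LFunctions.NumberField Literature.NumberTheory.Sieve.NumberFieldVaughan
  Literature.NumberTheory.Sieve.MaynardNF Literature.NumberTheory.Sieve.TypeTwoCoeff
open scoped Classical

namespace Literature.NumberTheory.Sieve.TotientHarmonic

variable {K : Type*} [Field K] [NumberField K]

/-! ## `2^{ω(𝔤)} ≤ τ(𝔤)` -/

/-- The squarefree divisors built from subsets of the prime factors are distinct divisors, so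
`2^{ω(𝔤)} ≤ τ(𝔤)`. [folklore] -/
theorem two_pow_card_primeFactors_le_card_divisors {𝔤 : Ideal (𝓞 K)} (h𝔤 : 𝔤 ≠ ⊥) :
    2 ^ (normalizedFactors 𝔤).toFinset.card ≤ (idealDivisors K 𝔤).card := by
  set PF := (normalizedFactors 𝔤).toFinset with hPF
  have hprime : ∀ P ∈ PF, Prime P := fun P hP => prime_of_normalized_factor P (Multiset.mem_toFinset.1 hP)
  -- the map `S ↦ ∏_{P ∈ S} P`
  have hdvd : ∀ S ∈ PF.powerset, (∏ P ∈ S, P) ∣ 𝔤 := by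
    intro S hS
    have h1 : (∏ P ∈ S, P) ∣ ∏ P ∈ PF, P := Finset.prod_dvd_prod_of_subset _ _ _ (Finset.mem_powerset.1 hS)
    have h2 : (∏ P ∈ PF, P) ∣ (normalizedFactors 𝔤).prod := Multiset.toFinset_prod_dvd_prod _
    have h3 : (normalizedFactors 𝔤).prod = 𝔤 := associated_iff_eq.1 (prod_normalizedFactors h𝔤)
    exact h1.trans (h3 ▸ h2)
  have hinj : Set.InjOn (fun S : Finset (Ideal (𝓞 K)) => ∏ P ∈ S, P) (PF.powerset : Set (Finset (Ideal (𝓞 K)))) := by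
    intro S hS T hT hST
    rw [Finset.mem_coe, Finset.mem_powerset] at hS hT
    simp only at hST
    have hSval : normalizedFactors (∏ P ∈ S, P) = S.val := by
      rw [Finset.prod_eq_multiset_prod, Multiset.map_id']
      exact normalizedFactors_prod_of_prime fun P hP => hprime P (hS (Finset.mem_val ▸ hP))
    have hTval : normalizedFactors (∏ P ∈ T, P) = T.val := by
      rw [Finset.prod_eq_multiset_prod, Multiset.map_id']
      exact normalizedFactors_prod_of_prime fun P hP => hprime P (hT (Finset.mem_val ▸ hP))
    rw [hST] at hSval
    exact Finset.val_inj.1 (hSval.symm.trans hTval)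
  calc 2 ^ PF.card = PF.powerset.card := (Finset.card_powerset PF).symm
    _ = (PF.powerset.image fun S => ∏ P ∈ S, P).card := (Finset.card_image_of_injOn hinj).symm
    _ ≤ (idealDivisors K 𝔤).card := Finset.card_le_card fun I hI => by
        obtain ⟨S, hS, rfl⟩ := Finset.mem_image.1 hI
        exact (mem_idealDivisors h𝔤).2 (hdvd S hS)

/-! ## `1/φ(𝔤) ≤ τ(𝔤)/N𝔤` -/

/-- **`φ(𝔤) ≥ N𝔤 · 2^{-ω(𝔤)}`** (each Euler factor is `≥ 1/2`). [folklore] -/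
theorem absNorm_le_two_pow_mul_idealTotient (𝔤 : Ideal (𝓞 K)) :
    (Ideal.absNorm 𝔤 : ℝ) ≤ 2 ^ (normalizedFactors 𝔤).toFinset.card * idealTotient K 𝔤 := by
  unfold idealTotient
  have hfac : ∀ P ∈ (normalizedFactors 𝔤).toFinset, (1 : ℝ) / 2 ≤ 1 - 1 / (Ideal.absNorm P : ℝ) := by
    intro P hP
    have hPp := prime_of_normalized_factor P (Multiset.mem_toFinset.1 hP)
    have hPm : P.IsMaximal := (Ideal.isPrime_of_prime hPp).isMaximal hPp.ne_zero
    have h2 : (2 : ℝ) ≤ Ideal.absNorm P := by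
      have := Ideal.absNorm_eq_one_iff.not.2 hPm.ne_top
      have h1 : 1 ≤ Ideal.absNorm P := Nat.one_le_iff_ne_zero.2 (by rw [Ne, Ideal.absNorm_eq_zero_iff]; exact hPp.ne_zero)
      have h1' : 1 < Ideal.absNorm P := lt_of_le_of_ne h1 (Ne.symm this)
      exact_mod_cast h1'
    have : 1 / (Ideal.absNorm P : ℝ) ≤ 1 / 2 := one_div_le_one_div_of_le two_pos h2
    linarith
  have hprod : ((1 : ℝ) / 2) ^ (normalizedFactors 𝔤).toFinset.card ≤
      ∏ P ∈ (normalizedFactors 𝔤).toFinset, (1 - 1 / (Ideal.absNorm P : ℝ)) := by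
    rw [← Finset.prod_const]
    exact Finset.prod_le_prod (fun _ _ => by norm_num) hfac
  have hN : (0 : ℝ) ≤ Ideal.absNorm 𝔤 := Nat.cast_nonneg _
  calc (Ideal.absNorm 𝔤 : ℝ) = 2 ^ (normalizedFactors 𝔤).toFinset.card *
        (Ideal.absNorm 𝔤 * (1 / 2) ^ (normalizedFactors 𝔤).toFinset.card) := by
          rw [← mul_assoc, mul_comm ((2 : ℝ) ^ _), mul_assoc, ← mul_pow]; norm_num
    _ ≤ 2 ^ (normalizedFactors 𝔤).toFinset.card *
        (Ideal.absNorm 𝔤 * ∏ P ∈ (normalizedFactors 𝔤).toFinset, (1 - 1 / (Ideal.absNorm P : ℝ))) := by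
          gcongr

/-- **`1/φ(𝔤) ≤ τ(𝔤)/N𝔤`** for `𝔤 ≠ 0`. [cite: Hinz1988, §2 p. 178] -/
theorem inv_idealTotient_le {𝔤 : Ideal (𝓞 K)} (h𝔤 : 𝔤 ≠ ⊥) :
    (idealTotient K 𝔤)⁻¹ ≤ (idealDivisors K 𝔤).card / (Ideal.absNorm 𝔤 : ℝ) := by
  have hφ := idealTotient_pos (K := K) h𝔤
  have hN := absNorm_pos_of_ne_bot h𝔤
  have h1 := absNorm_le_two_pow_mul_idealTotient 𝔤
  have h2 : (2 : ℝ) ^ (normalizedFactors 𝔤).toFinset.card ≤ (idealDivisors K 𝔤).card := by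
    exact_mod_cast two_pow_card_primeFactors_le_card_divisors h𝔤
  have hτ : (0 : ℝ) < (idealDivisors K 𝔤).card := lt_of_lt_of_le (by positivity) h2
  rw [inv_le_comm₀ hφ (div_pos hτ hN), inv_div, div_le_iff₀ hτ]
  calc (Ideal.absNorm 𝔤 : ℝ) ≤ 2 ^ (normalizedFactors 𝔤).toFinset.card * idealTotient K 𝔤 := h1
    _ ≤ (idealDivisors K 𝔤).card * idealTotient K 𝔤 := mul_le_mul_of_nonneg_right h2 hφ.le
    _ = idealTotient K 𝔤 * (idealDivisors K 𝔤).card := mul_comm _ _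

/-! ## `∑ τ(𝔤)/N𝔤 ≤ (∑ 1/N𝔡)²` -/

/-- **`∑_{N𝔤≤Q} τ(𝔤)/N𝔤 ≤ (∑_{N𝔡≤Q} 1/N𝔡)²`** (the pairs `(𝔡, 𝔤/𝔡)`). [folklore] -/
theorem sum_card_divisors_div_le (Q : ℝ) :
    ∑ 𝔤 ∈ idealsLE K Q, (idealDivisors K 𝔤).card / (Ideal.absNorm 𝔤 : ℝ) ≤
      (∑ 𝔡 ∈ idealsLE K Q, ((Ideal.absNorm 𝔡 : ℕ) : ℝ)⁻¹) ^ 2 := by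
  set L := idealsLE K Q with hL
  -- as a sum over pairs `(𝔤, 𝔡)`, `𝔡 ∣ 𝔤`
  have hlhs : ∑ 𝔤 ∈ L, (idealDivisors K 𝔤).card / (Ideal.absNorm 𝔤 : ℝ) =
      ∑ p ∈ L.sigma (fun 𝔤 => idealDivisors K 𝔤), ((Ideal.absNorm p.1 : ℕ) : ℝ)⁻¹ := by
    rw [Finset.sum_sigma]
    refine Finset.sum_congr rfl fun 𝔤 _ => ?_
    simp only [Finset.sum_const, nsmul_eq_mul, div_eq_mul_inv]
  rw [hlhs]
  set e : (Σ _ : Ideal (𝓞 K), Ideal (𝓞 K)) → Ideal (𝓞 K) × Ideal (𝓞 K) := fun p => (p.2, cofactor p.1 p.2) with he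
  set F : Ideal (𝓞 K) × Ideal (𝓞 K) → ℝ := fun q => ((Ideal.absNorm q.1 : ℕ) : ℝ)⁻¹ * ((Ideal.absNorm q.2 : ℕ) : ℝ)⁻¹
    with hF
  have hF0 : ∀ q, 0 ≤ F q := fun q => by simp only [hF]; positivity
  have hmem : ∀ p ∈ L.sigma (fun 𝔤 => idealDivisors K 𝔤), p.1 ≠ ⊥ ∧ (Ideal.absNorm p.1 : ℝ) ≤ Q ∧ p.2 ∣ p.1 := by
    intro p hp
    rw [Finset.mem_sigma, hL, mem_idealsLE] at hp
    exact ⟨hp.1.1, hp.1.2, (mem_idealDivisors hp.1.1).1 hp.2⟩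
  have hterm : ∀ p ∈ L.sigma (fun 𝔤 => idealDivisors K 𝔤), ((Ideal.absNorm p.1 : ℕ) : ℝ)⁻¹ = F (e p) := by
    intro p hp
    obtain ⟨_, _, hd⟩ := hmem p hp
    simp only [hF, he]
    rw [← mul_inv, ← Nat.cast_mul, ← map_mul, mul_cofactor hd]
  have hinj : Set.InjOn e (L.sigma (fun 𝔤 => idealDivisors K 𝔤) : Set _) := by
    intro p hp p' hp' h
    rw [Finset.mem_coe] at hp hp'
    simp only [he, Prod.mk.injEq] at h
    obtain ⟨h1, h2⟩ := h
    have hd := (hmem p hp).2.2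
    have hd' := (hmem p' hp').2.2
    have hfst : p.1 = p'.1 := by
      have e1 := mul_cofactor hd
      have e2 := mul_cofactor hd'
      rw [← e1, ← e2, h2, h1]
    exact Sigma.ext hfst (heq_of_eq h1)
  have hdvd_mem : ∀ {𝔞 𝔟 : Ideal (𝓞 K)}, 𝔞 ∈ L → 𝔟 ∣ 𝔞 → 𝔟 ∈ L := by
    intro 𝔞 𝔟 h𝔞 hdvd
    rw [hL, mem_idealsLE] at h𝔞 ⊢
    refine ⟨fun h => h𝔞.1 ?_, le_trans ?_ h𝔞.2⟩
    · obtain ⟨c, rfl⟩ := hdvd; rw [h]; simp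
    · have hpos : 0 < Ideal.absNorm 𝔞 := Nat.pos_of_ne_zero (by rw [Ne, Ideal.absNorm_eq_zero_iff]; exact h𝔞.1)
      exact_mod_cast Nat.le_of_dvd hpos (Ideal.absNorm_dvd_absNorm_of_le (Ideal.le_of_dvd hdvd))
  have himage : (L.sigma (fun 𝔤 => idealDivisors K 𝔤)).image e ⊆ L ×ˢ L := by
    intro q hq
    obtain ⟨p, hp, rfl⟩ := Finset.mem_image.1 hq
    have hp' := Finset.mem_sigma.1 hp
    obtain ⟨_, _, hd⟩ := hmem p hp
    simp only [he, Finset.mem_product]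
    exact ⟨hdvd_mem hp'.1 hd, hdvd_mem hp'.1 (cofactor_dvd hd)⟩
  calc ∑ p ∈ L.sigma (fun 𝔤 => idealDivisors K 𝔤), ((Ideal.absNorm p.1 : ℕ) : ℝ)⁻¹
      = ∑ p ∈ L.sigma (fun 𝔤 => idealDivisors K 𝔤), F (e p) := Finset.sum_congr rfl hterm
    _ = ∑ q ∈ (L.sigma (fun 𝔤 => idealDivisors K 𝔤)).image e, F q := (Finset.sum_image hinj).symm
    _ ≤ ∑ q ∈ L ×ˢ L, F q := Finset.sum_le_sum_of_subset_of_nonneg himage fun q _ _ => hF0 q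
    _ = (∑ 𝔡 ∈ L, ((Ideal.absNorm 𝔡 : ℕ) : ℝ)⁻¹) ^ 2 := by
        rw [Finset.sum_product L L F, sq, Finset.sum_mul_sum]

/-! ## The conclusions -/

/-- **`∑_{N𝔤≤Q} 1/φ(𝔤) ≤ (∑_{N𝔡≤Q} 1/N𝔡)²`.** [cite: Hinz1988, §2 p. 178] -/
theorem sum_inv_idealTotient_le (Q : ℝ) :
    ∑ 𝔤 ∈ idealsLE K Q, (idealTotient K 𝔤)⁻¹ ≤ (∑ 𝔡 ∈ idealsLE K Q, ((Ideal.absNorm 𝔡 : ℕ) : ℝ)⁻¹) ^ 2 :=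
  (Finset.sum_le_sum fun _ h𝔤 => inv_idealTotient_le (mem_idealsLE.1 h𝔤).1).trans (sum_card_divisors_div_le Q)

variable (K) in
/-- **`∑_{N𝔤≤Q} 1/φ(𝔤) ≤ C (1 + log Q)²`** for `Q ≥ 1`. [cite: Hinz1988, §2 p. 178] -/
theorem sum_inv_idealTotient_le_log_sq : ∃ C : ℝ, 0 < C ∧ ∀ Q : ℝ, 1 ≤ Q →
    ∑ 𝔤 ∈ idealsLE K Q, (idealTotient K 𝔤)⁻¹ ≤ C * (1 + Real.log Q) ^ 2 := by
  obtain ⟨C, hC, hH⟩ := harmonic_le K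
  refine ⟨C ^ 2, by positivity, fun Q hQ => ?_⟩
  have h := hH Q hQ
  have h0 := harmonic_nonneg (K := K) Q
  calc ∑ 𝔤 ∈ idealsLE K Q, (idealTotient K 𝔤)⁻¹ ≤ (∑ 𝔡 ∈ idealsLE K Q, ((Ideal.absNorm 𝔡 : ℕ) : ℝ)⁻¹) ^ 2 :=
        sum_inv_idealTotient_le Q
    _ ≤ (C * (1 + Real.log Q)) ^ 2 := pow_le_pow_left₀ h0 h 2
    _ = C ^ 2 * (1 + Real.log Q) ^ 2 := by ring

end Literature.NumberTheory.Sieve.TotientHarmonic
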